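import Summits.BirchSwinnertonDyer.BirchSwinnertonDyer.Theorems.ErratumRoadFiveRegCertKernelFiveChecker
import HarnessLib

/-!
# Route `ErratumRoadFive` (rung K2, `p ≥ 5`), crux `RamNoErratumDataAtFive` (item stmt-BirchSwinnertonDyer-19624, REST‴):
# the GENERIC first-order REG5CERT kernel checker AT ARBITRARY DEPTH `K ≥ 1`, part 1: the PARAMETRIC series estimates
# `‖log_Ŵ z − (z + a₁z²∕2)‖ ≤ 5^{−3K}` (`‖z‖ ≤ 5⁻ᴷ`), `‖ch w − (1 + w∕2)‖ ≤ ‖w‖²`, `‖σ_q²(ch w) − w‖ ≤ ‖w‖²` (`‖w‖ ≤ 5⁻²`) (cell `bsd-stepL`, OWNER seat `bsd-stepL-rest-p2` g8; `--supports stmt-BirchSwinnertonDyer-19624`)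

HONEST FRAMING: BSD is not proved by any of this; nothing here closes the crux; Schneider's non-degeneracy conjecture
(barrier `Literature.Barriers.BirchSwinnertonDyer.PAdicHeightNondegeneracy`) is asserted NOWHERE; every application is ONE curve.
WHY (census HOME/rest/DEEPCENSUS-REST4at5.md v3): of the 4 114 NON-split REST⁗@5 pairs of Cremona's range, 326 have their first admissible point at
a level `k₀ > ν = v₅(Δ)` — out of the regime `k ≤ ν` of seat tam3-p2's exact (4.1) row checker — and 293 of those have `v₅(ĥ(Q)) ≤ k₀`, i.e. are
decided by the FIRST-ORDER argument at depth `k₀ ∈ {3, 4, 5}`, which has NO `ν`-regime (the scale `C²` cancels; only `5 ∤ c₄c₆` enters). The member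
TR8 = 3510j1 ⊗ 857 of crux 19624's TR (`Q = 40·g`, depth 3, `ν = 2`, `v₅(ĥ₄.₁(Q)) = 2`, `λ = 504`, `λ⁸ − e'⁸ ≡ 175 (mod 625)`) is such a row
(its (4.1) half; file `…Rest3TRLeverCertKernelSplit41B.lean` next). The argument is g7's verbatim with `25 ↦ 5ᴷ`: `den x = 5^{2K}e'²`,
`log_Ŵ(z) ≡ 5ᴷλ (mod 5^{−(2K+1)})` from `5^{K+1} ∣ −2ae'b + 5ᴷa₁a²e'² − 2λb²`, `C²σ² ≡ 5^{2K}λ² (mod 5^{2K}·5^{−(K+1)})`, and equal Iwasawa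
logarithms would force `5^{K+1} ∣ λ⁸ − e'⁸` (`padicLog_ne_padicLog_of_unitResidue`, `P = 5^{2K}`, `N = K + 1`).

* THIS FILE (§0–§1): `norm_coshOfSq_sub_le_sq`, `norm_tateSigmaSq_coshOfSq_sub_le_sq`, `norm_padicFormalLog_sub_quadratic_le_depth`;
* part 2 (`…RegCertKernelFiveDepthK.lean`): `heightFourOneCoord_ne_zero_of_certDepth`, `certNonsplit_of_certDepth`.
Theorems only (0 defs, 0 facts, no `native_decide`); route-free. References: [SteinWuthrich2013] §4.2; [MazurSteinTate2006] §1;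
[SilvermanAEC2009] IV.6.3–6.4, VII.3.4; [Iwasawa1972PadicL] §4.4.
-/

open scoped Classical

open Filter Topology PowerSeries IsUltrametricDist WeierstrassCurve Literature.NumberTheory.EllipticCurves
  Literature.NumberTheory.EllipticCurves.Rank1Residual
  Literature.NumberTheory.EllipticCurves.SteinWuthrich2013
  Summit.BirchSwinnertonDyer.Rank1Residual
  Summit.BirchSwinnertonDyer.Rank1Residual.X11b
  Summit.BirchSwinnertonDyer.Rank1Residual.X11b.RegMult.Rung62310y1

namespace Summit.BirchSwinnertonDyer.Rank1Residual.X11b.RegMult.KernelCertFive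

/-! ### §0 Plumbing in `ℚ₅` and in `ℝ` -/

/-- In `ℚ₅`, `‖x‖ < 1 ⇒ ‖x‖ ≤ 5⁻¹`. [folklore] -/
private theorem norm_le_fifth_of_norm_lt_one₈ {x : ℚ_[5]} (hx : ‖x‖ < 1) : ‖x‖ ≤ 1 / 5 := by
  have h := norm_le_inv_of_norm_lt_one (p := 5) hx
  rw [one_div]; exact_mod_cast h

/-- **Legendre at `p = 5`**: `‖1/(2n)!‖₅ ≤ 5ⁿ`. [cite: SilvermanAEC2009, IV.6.3] -/
private theorem norm_inv_factorial_le₈ (n : ℕ) : ‖(((2 * n).factorial : ℕ) : ℚ_[5])⁻¹‖ ≤ (5 : ℝ) ^ n := by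
  have hf : ((2 * n).factorial : ℕ) ≠ 0 := Nat.factorial_ne_zero _
  rw [norm_inv, Padic.norm_eq_zpow_neg_valuation (by exact_mod_cast hf), Padic.valuation_natCast, zpow_neg,
    inv_inv, zpow_natCast]
  have hv : padicValNat 5 (2 * n).factorial ≤ n := by
    have h := sub_one_mul_padicValNat_factorial (p := 5) (2 * n)
    have hs : (5 - 1) * padicValNat 5 (2 * n).factorial ≤ 2 * n := by rw [h]; exact Nat.sub_le _ _
    omega
  exact_mod_cast Nat.pow_le_pow_right (by norm_num) hv

/-! ### §1 Parametric series estimates -/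

/-- **`‖ch(w) − (1 + w/2)‖₅ ≤ ‖w‖²` for `‖w‖₅ ≤ 5⁻²`**: `‖w²/24‖ = ‖w‖²`, `‖w³/720‖ = 5‖w‖³ ≤ ‖w‖²`, and every later term
`‖wⁿ⁺⁴/(2n+8)!‖ ≤ 5ⁿ⁺⁴‖w‖ⁿ⁺⁴ ≤ ‖w‖²`. [folklore] -/
theorem norm_coshOfSq_sub_le_sq {w : ℚ_[5]} (hw : ‖w‖ ≤ 1 / 25) :
    ‖coshOfSq w - (1 + w / 2)‖ ≤ ‖w‖ ^ 2 := by
  have hs := summable_coshOfSq_term_depthOne hw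
  have hsplit := hs.sum_add_tsum_nat_add 4
  have hdef : coshOfSq w = ∑' n : ℕ, w ^ n / (((2 * n).factorial : ℕ) : ℚ_[5]) := by rw [coshOfSq]
  rw [hdef, ← hsplit]
  simp only [Finset.sum_range_succ, Finset.sum_range_zero, zero_add, pow_zero, Nat.mul_zero, Nat.factorial_zero,
    Nat.cast_one, div_one, pow_one]
  have h2 : (((2 * 1).factorial : ℕ) : ℚ_[5]) = 2 := by norm_num [Nat.factorial]
  have h24 : (((2 * 2).factorial : ℕ) : ℚ_[5]) = 24 := by norm_num [Nat.factorial]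
  have h720 : (((2 * 3).factorial : ℕ) : ℚ_[5]) = 720 := by norm_num [Nat.factorial]
  rw [h2, h24, h720]
  have hring : 1 + w / 2 + w ^ 2 / 24 + w ^ 3 / 720 +
      ∑' n : ℕ, w ^ (n + 4) / (((2 * (n + 4)).factorial : ℕ) : ℚ_[5]) - (1 + w / 2) =
      w ^ 2 / 24 + (w ^ 3 / 720 + ∑' n : ℕ, w ^ (n + 4) / (((2 * (n + 4)).factorial : ℕ) : ℚ_[5])) := by ring
  rw [hring]
  have hw0 : 0 ≤ ‖w‖ := norm_nonneg _
  refine (IsUltrametricDist.norm_add_le_max _ _).trans (max_le ?_ ?_)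
  · have h24n : ‖((24 : ℚ_[5]))⁻¹‖ = 1 := by
      rw [norm_inv, show (24 : ℚ_[5]) = ((24 : ℤ) : ℚ_[5]) by norm_cast, norm_intCast_eq_one_of_not_dvd (by decide),
        inv_one]
    rw [div_eq_mul_inv, norm_mul, norm_pow, h24n, mul_one]
  refine (IsUltrametricDist.norm_add_le_max _ _).trans (max_le ?_ ?_)
  · have h720n : ‖((720 : ℚ_[5]))⁻¹‖ = 5 := by
      rw [norm_inv, show (720 : ℚ_[5]) = ((720 : ℕ) : ℚ_[5]) by norm_cast,
        Padic.norm_eq_zpow_neg_valuation (by norm_num), Padic.valuation_natCast]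
      have : padicValNat 5 720 = 1 := by
        have h1 : 1 ≤ padicValNat 5 720 := (padicValNat_dvd_iff_le (by norm_num)).mp (by norm_num)
        have h2 : ¬ 2 ≤ padicValNat 5 720 := fun h => by
          have := (padicValNat_dvd_iff_le (p := 5) (n := 2) (by norm_num : (720 : ℕ) ≠ 0)).mpr h; norm_num at this
        omega
      rw [this]; norm_num
    rw [div_eq_mul_inv, norm_mul, norm_pow, h720n]
    -- `5‖w‖³ ≤ ‖w‖²` since `5‖w‖ ≤ 1`
    have h5w : ‖w‖ * 5 ≤ 1 := by nlinarith
    calc ‖w‖ ^ 3 * 5 = ‖w‖ ^ 2 * (‖w‖ * 5) := by ring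
      _ ≤ ‖w‖ ^ 2 * 1 := by gcongr
      _ = ‖w‖ ^ 2 := mul_one _
  · refine IsUltrametricDist.norm_tsum_le_of_forall_le_of_nonneg (by positivity) fun n ↦ ?_
    rw [div_eq_mul_inv, norm_mul, norm_pow]
    have hf := norm_inv_factorial_le₈ (n + 4)
    -- `‖w‖^{n+4}·5^{n+4} = ‖w‖²·(‖w‖^{n+2}·5^{n+4})` and `‖w‖^{n+2}·5^{n+4} ≤ (1/25)^{n+2}·5^{n+4} ≤ 1`
    have hsmall : ‖w‖ ^ (n + 2) * (5 : ℝ) ^ (n + 4) ≤ 1 := by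
      have h1 : ‖w‖ ^ (n + 2) ≤ (1 / 25 : ℝ) ^ (n + 2) := by gcongr
      have h2 : (1 / 25 : ℝ) ^ (n + 2) * (5 : ℝ) ^ (n + 4) = 1 / (5 : ℝ) ^ n := by
        rw [show (1 / 25 : ℝ) = 1 / (5 : ℝ) ^ 2 by norm_num, one_div_pow, ← pow_mul]
        field_simp
        ring
      calc ‖w‖ ^ (n + 2) * (5 : ℝ) ^ (n + 4) ≤ (1 / 25 : ℝ) ^ (n + 2) * (5 : ℝ) ^ (n + 4) := by gcongr
        _ = 1 / (5 : ℝ) ^ n := h2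
        _ ≤ 1 := by
            rw [div_le_one (by positivity)]
            exact one_le_pow₀ (by norm_num)
    calc ‖w‖ ^ (n + 4) * ‖(((2 * (n + 4)).factorial : ℕ) : ℚ_[5])⁻¹‖ ≤ ‖w‖ ^ (n + 4) * (5 : ℝ) ^ (n + 4) := by
          gcongr
      _ = ‖w‖ ^ 2 * (‖w‖ ^ (n + 2) * (5 : ℝ) ^ (n + 4)) := by ring
      _ ≤ ‖w‖ ^ 2 * 1 := by gcongr
      _ = ‖w‖ ^ 2 := mul_one _

/-- **`σ_q²(ch(w)) = w + O(‖w‖²)`**: for `‖q‖₅ < 1` and `‖w‖₅ ≤ 5⁻²`, `‖tateSigmaSq q (coshOfSq w) − w‖₅ ≤ ‖w‖²`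
(`σ² = 2(c − 1)·Π`, `‖2(c − 1) − w‖ ≤ ‖w‖²`, `‖Π − 1‖ ≤ ‖q‖·‖c − 1‖ ≤ 5⁻¹‖w‖`). [cite: SteinWuthrich2013, §4.2] -/
theorem norm_tateSigmaSq_coshOfSq_sub_le_sq {q w : ℚ_[5]} (hq : ‖q‖ < 1) (hw : ‖w‖ ≤ 1 / 25) :
    ‖tateSigmaSq q (coshOfSq w) - w‖ ≤ ‖w‖ ^ 2 := by
  set c := coshOfSq w with hc
  obtain ⟨-, hcle⟩ := norm_coshOfSq_sub_one_le_depthOne hw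
  have hch := norm_coshOfSq_sub_le_sq hw
  have hw0 : 0 ≤ ‖w‖ := norm_nonneg _
  -- `‖c − 1‖ ≤ ‖w‖`
  have hc1 : ‖c - 1‖ ≤ ‖w‖ := by
    have hw2 : ‖w / 2‖ = ‖w‖ := by rw [div_eq_mul_inv, norm_mul, norm_inv_two₅, mul_one]
    have : c - 1 = (c - (1 + w / 2)) + w / 2 := by ring
    rw [this]
    refine (IsUltrametricDist.norm_add_le_max _ _).trans (max_le (hch.trans ?_) hw2.le)
    calc ‖w‖ ^ 2 = ‖w‖ * ‖w‖ := sq _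
      _ ≤ ‖w‖ * 1 := by gcongr; exact hw.trans (by norm_num)
      _ = ‖w‖ := mul_one _
  have hq5 : ‖q‖ ≤ 1 / 5 := norm_le_fifth_of_norm_lt_one₈ hq
  set P := ∏' n : ℕ, (1 - 2 * q ^ (n + 1) * c + q ^ (2 * (n + 1))) ^ 2 / (1 - q ^ (n + 1)) ^ 4 with hP
  have hP1 : ‖P - 1‖ ≤ 1 / 5 * ‖w‖ := by
    refine (norm_tprod_tateSigmaSq_factor_sub_one_le hq hcle).trans ?_
    gcongr
  have hPle : ‖P‖ ≤ 1 := by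
    have : P = (P - 1) + 1 := by ring
    rw [this]
    refine (IsUltrametricDist.norm_add_le_max _ _).trans (max_le (hP1.trans ?_) (by rw [norm_one]))
    calc 1 / 5 * ‖w‖ ≤ 1 / 5 * (1 / 25) := by gcongr
      _ ≤ 1 := by norm_num
  have hdef : tateSigmaSq q c = 2 * (c - 1) * P := by rw [tateSigmaSq]
  have hsplit : tateSigmaSq q c - w = (2 * (c - (1 + w / 2))) * P + w * (P - 1) := by rw [hdef]; ring
  rw [hsplit]
  refine (IsUltrametricDist.norm_add_le_max _ _).trans (max_le ?_ ?_)
  · rw [norm_mul, norm_mul]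
    have h2 : ‖(2 : ℚ_[5])‖ ≤ 1 := by
      rw [show (2 : ℚ_[5]) = ((2 : ℤ) : ℚ_[5]) by norm_cast]; exact Padic.norm_int_le_one _
    calc ‖(2 : ℚ_[5])‖ * ‖c - (1 + w / 2)‖ * ‖P‖ ≤ 1 * ‖w‖ ^ 2 * 1 := by gcongr
      _ = ‖w‖ ^ 2 := by ring
  · rw [norm_mul]
    calc ‖w‖ * ‖P - 1‖ ≤ ‖w‖ * (1 / 5 * ‖w‖) := by gcongr
      _ = ‖w‖ ^ 2 * (1 / 5) := by ring
      _ ≤ ‖w‖ ^ 2 * 1 := by gcongr; norm_num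
      _ = ‖w‖ ^ 2 := mul_one _

section Padic

variable (V : WeierstrassCurve ℚ_[5]) [V.IsIntegral ℤ_[5]]

/-- `(n + 3)·5^{3K} ≤ 5^{K(n+3)}` for `K ≥ 1`, `n ≥ 2` (`n + 3 ≤ 5ⁿ ≤ 5^{Kn}`). [folklore] -/
private theorem mul_pow_le_pow_depth {K : ℕ} (hK : 1 ≤ K) {n : ℕ} (hn : 2 ≤ n) : (n + 3) * 5 ^ (3 * K) ≤ 5 ^ (K * (n + 3)) := by
  have h1 : n + 3 ≤ 5 ^ n := by
    induction n with
    | zero => omega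
    | succ m ih =>
      rcases Nat.lt_or_ge m 2 with hm | hm
      · interval_cases m <;> norm_num
      · calc m + 1 + 3 = (m + 3) + 1 := by ring
          _ ≤ 5 ^ m + 5 ^ m := Nat.add_le_add (ih hm) (Nat.one_le_pow _ _ (by norm_num))
          _ ≤ 5 ^ (m + 1) := by rw [pow_succ]; omega
  have h2 : 5 ^ n ≤ 5 ^ (K * n) := Nat.pow_le_pow_right (by norm_num) (Nat.le_mul_of_pos_left n (by omega))
  calc (n + 3) * 5 ^ (3 * K) ≤ 5 ^ (K * n) * 5 ^ (3 * K) := Nat.mul_le_mul_right _ (h1.trans h2)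
    _ = 5 ^ (K * (n + 3)) := by rw [← pow_add]; congr 1; ring

/-- The terms of degree `≥ 3` of `log_Ŵ(z)` have norm `≤ 5^{−3K}` for `‖z‖₅ ≤ 5⁻ᴷ`, `K ≥ 1` (`‖1/n‖₅ ≤ n`).
[cite: SilvermanAEC2009, IV.6.3] -/
private theorem norm_formalLog_term_le_depth {K : ℕ} (hK : 1 ≤ K) {z : ℚ_[5]} (hz : ‖z‖ ≤ 1 / (5 : ℝ) ^ K) (n : ℕ) :
    ‖coeff (n + 3) V.formalLog * z ^ (n + 3)‖ ≤ 1 / (5 : ℝ) ^ (3 * K) := by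
  rw [norm_mul, norm_pow]
  have hc := (norm_coeff_formalLog_le_norm_inv V) (n + 1)
  rw [show n + 1 + 2 = n + 3 by ring] at hc
  have hzn : ‖z‖ ^ (n + 3) ≤ (1 / (5 : ℝ) ^ K) ^ (n + 3) := by gcongr
  have hle1 : 1 / (5 : ℝ) ^ K ≤ 1 := by
    rw [div_le_one (by positivity)]; exact one_le_pow₀ (by norm_num)
  rcases Nat.lt_or_ge n 2 with hn | hn
  · have hunit : ‖(((n + 3 : ℕ) : ℚ_[5]))⁻¹‖ = 1 := by
      rw [norm_inv, Padic.norm_eq_zpow_neg_valuation (by exact_mod_cast (show (n + 3 : ℕ) ≠ 0 by omega)),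
        Padic.valuation_natCast,
        padicValNat.eq_zero_of_not_dvd (by interval_cases n <;> norm_num)]
      simp
    calc ‖coeff (n + 3) V.formalLog‖ * ‖z‖ ^ (n + 3) ≤ 1 * (1 / (5 : ℝ) ^ K) ^ (n + 3) := by
          gcongr; exact hc.trans hunit.le
      _ ≤ 1 * (1 / (5 : ℝ) ^ K) ^ 3 :=
          mul_le_mul_of_nonneg_left (pow_le_pow_of_le_one (by positivity) hle1 (by omega)) (by norm_num)
      _ = 1 / (5 : ℝ) ^ (3 * K) := by rw [one_mul, one_div_pow, ← pow_mul, mul_comm]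
  · have hm : ‖(((n + 3 : ℕ) : ℚ_[5]))⁻¹‖ ≤ ((n + 3 : ℕ) : ℝ) := padic_norm_inv_natCast_le (n + 3)
    have hpow := mul_pow_le_pow_depth hK hn
    have hpow' : ((n + 3 : ℕ) : ℝ) * (5 : ℝ) ^ (3 * K) ≤ (5 : ℝ) ^ (K * (n + 3)) := by exact_mod_cast hpow
    calc ‖coeff (n + 3) V.formalLog‖ * ‖z‖ ^ (n + 3) ≤ ((n + 3 : ℕ) : ℝ) * (1 / (5 : ℝ) ^ K) ^ (n + 3) := by
          gcongr; exact hc.trans hm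
      _ = ((n + 3 : ℕ) : ℝ) / (5 : ℝ) ^ (K * (n + 3)) := by rw [one_div_pow, ← pow_mul]; ring
      _ ≤ 1 / (5 : ℝ) ^ (3 * K) := by
          rw [div_le_div_iff₀ (by positivity) (by positivity)]
          linarith

/-- **`log_Ŵ(z) = z + (a₁/2)z² + O(5^{−3K})` on `‖z‖₅ ≤ 5⁻ᴷ`** (`K ≥ 1`) for a `5`-integral equation over `ℚ₅`.
[cite: SilvermanAEC2009, IV.6.4] -/
theorem norm_padicFormalLog_sub_quadratic_le_depth {K : ℕ} (hK : 1 ≤ K) {z : ℚ_[5]} (hz : ‖z‖ ≤ 1 / (5 : ℝ) ^ K) :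
    ‖V.padicFormalLog z - (z + (2 : ℚ_[5])⁻¹ * V.a₁ * z ^ 2)‖ ≤ 1 / (5 : ℝ) ^ (3 * K) := by
  have hz1 : ‖z‖ < 1 := hz.trans_lt (by
    rw [div_lt_one (by positivity)]; exact one_lt_pow₀ (by norm_num) (by omega))
  have hs := V.summable_formalLog_of_isIntegral z hz1
  have hsplit := hs.sum_add_tsum_nat_add 3
  have h0 : coeff 0 V.formalLog = 0 := by rw [coeff_zero_eq_constantCoeff]; exact V.constantCoeff_formalLog
  have h2 : coeff 2 V.formalLog = (2 : ℚ_[5])⁻¹ * V.a₁ := by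
    rw [(coeff_two_formalLog V), eq_ratCast]; push_cast; ring
  have hthree : ∑ i ∈ Finset.range 3, coeff i V.formalLog * z ^ i = z + (2 : ℚ_[5])⁻¹ * V.a₁ * z ^ 2 := by
    simp only [Finset.sum_range_succ, Finset.sum_range_zero, h0, V.coeff_one_formalLog, h2]
    ring
  rw [WeierstrassCurve.padicFormalLog, ← hsplit, hthree, add_sub_cancel_left]
  exact IsUltrametricDist.norm_tsum_le_of_forall_le_of_nonneg (by positivity) fun n ↦
    (norm_formalLog_term_le_depth V hK) hz n

end Padic

end Summit.BirchSwinnertonDyer.Rank1Residual.X11b.RegMult.KernelCertFive
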